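import Literature.AnabelianGeometry.EtaleTheta.DivisorMonoidsOfGaloisCovering

/-!
# [EtTh] Def. 3.1 / Prop. 3.2 / Def. 3.3: a NON-DEGENERATE inhabitant of the universal-combinatorial-covering
# interface with its Galois action — the combinatorial skeleton of the Tate tower

S. Mochizuki, *The étale theta function …*, Publ. RIMS **45** (2009) [MochizukiEtTh2009], §3, Def. 3.1 / Prop. 3.2
(PRIMS PDF p.70), Def. 3.3 (iii) / Rmk. 3.3.1 (p.73); the motivating picture is §1, p.12: the universal combinatorial
covering of a Tate curve is "an infinite chain of copies of the projective line", its Galois group `ℤ` acting by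
translation, with the coordinate `U` a meromorphic function whose divisor runs linearly along the chain
[cite: MochizukiEtTh2009, Def 3.1 p.70].

CLASS (b) MODEL / NON-VACUITY WITNESS (abc-iut cell; `LogDivisorModel` (v3), `GaloisAction`, `CuspLaws`,
consumed BY NAME).  The only previous `LogDivisorModel` inhabitant was the trivial `toy`; every
Galois-action witness was trivial.  The **Tate tower skeleton**: components of the special fibre indexed by `ℤ` (the
infinite chain), no cusps, `DIV = ℤ^ℤ`, every log-divisor Cartier; functions `Fn = ⟨ϖ⟩ × ⟨U⟩ ≅ ℤ²` (`ϖ` the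
uniformiser: divisor = the whole special fibre; `U` the Tate coordinate: divisor `n ↦ n`); constants `⟨ϖ⟩`,
`O^▷ = ϖ^ℕ`; Prop. 3.2 (ii) holds NON-trivially (`ϖ^c U^k` has effective divisor iff `k = 0 ∧ c ≥ 0`,
`divFun_nonneg_iff`); `G = ℤ` acts by TRANSLATION of the chain (`n ↦ n + g` on components, `d ↦ d(· − g)` on
divisors, `ϖ^c U^k ↦ ϖ^{c−kg} U^k` on functions), all `GaloisAction` laws proved (`TateTower.action`), with the cusp
laws (`TateTower.cuspLaws`); the constants are `G`-fixed (so the Galois-correspondence binder of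
`LogDivisorModelConstantField.lean` holds with `N = G` — recorded in a sequel once that module is built).  Hence `DivisorMonoids.ofGaloisAction TateTower.action
TateTower.cuspLaws` is a Def. 3.3 (iii) datum with a NON-TRIVIAL action (`nonempty_divisorMonoids`), and
`B₀(ℤ/1) ∋ U` is genuinely bigger than the constants (`coordU_not_mem_fZero`).
HONEST FRAMING: a combinatorial consistency witness for the typed interfaces (it is NOT the formal-scheme tower of
a Tate curve, only its divisor/Galois skeleton); nothing here bears on [IUTchIII] Cor. 3.12; typed ≠ proved.
-/

noncomputable section

namespace Literature.AnabelianGeometry.EtaleTheta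

open CategoryTheory

namespace LogDivisorModel

namespace TateTower

/-- Index of prime log-divisors of the Tate tower: no cusps, components `ℤ`. [cite: MochizukiEtTh2009, Def 3.1 p.70] -/
abbrev Idx : Type := PEmpty.{1} ⊕ ℤ
/-- The position of a prime log-divisor on the chain (cusps do not occur). [cite: MochizukiEtTh2009, Def 3.1 p.70] -/
def pos : Idx → ℤ
  | Sum.inl c => c.elim
  | Sum.inr n => n

/-- The divisor of `ϖ^c U^k`: the function `n ↦ c + k·n` on the chain (additively).
[cite: MochizukiEtTh2009, Def 3.1 p.70] -/
def divFun (f : ℤ × ℤ) : Idx → ℤ := fun x => f.1 + f.2 * pos x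
/-- `divFun` is additive. [cite: MochizukiEtTh2009, Def 3.1 p.70] -/
theorem divFun_add (f g : ℤ × ℤ) : divFun (f + g) = divFun f + divFun g := by
  funext x; simp only [divFun, Prod.fst_add, Prod.snd_add, Pi.add_apply]; ring

/-- The divisor map `Fn = ℤ² → DIV = ℤ^ℤ` as a homomorphism of multiplicative groups.
[cite: MochizukiEtTh2009, Def 3.1 p.70] -/
def divHom : Multiplicative (ℤ × ℤ) →* Multiplicative (Idx → ℤ) :=
  AddMonoidHom.toMultiplicative
    { toFun := divFun
      map_zero' := by funext x; simp [divFun]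
      map_add' := divFun_add }
/-- `divHom` on elements. [cite: MochizukiEtTh2009, Def 3.1 p.70] -/
@[simp] theorem toAdd_divHom (f : Multiplicative (ℤ × ℤ)) (x : Idx) :
    Multiplicative.toAdd (divHom f) x = (Multiplicative.toAdd f).1 + (Multiplicative.toAdd f).2 * pos x := rfl

/-- **Key computation (Prop. 3.2 (ii) for the tower)**: `n ↦ c + k n` is non-negative on all of `ℤ` iff `k = 0` and
`c ≥ 0`. [cite: MochizukiEtTh2009, Prop 3.2 p.70] -/
theorem divFun_nonneg_iff (f : ℤ × ℤ) : (∀ x, 0 ≤ divFun f x) ↔ f.2 = 0 ∧ 0 ≤ f.1 := by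
  constructor
  · intro h
    have h0 := h (Sum.inr 0)
    simp only [divFun, pos, mul_zero, add_zero] at h0
    by_contra hne
    have hk : f.2 ≠ 0 := fun hk => hne ⟨hk, h0⟩
    -- evaluate at `n = -(f.2 * (f.1 + 1))`: `c + k n = c - k² (c + 1) < 0`
    have h1 := h (Sum.inr (-(f.2 * (f.1 + 1))))
    simp only [divFun, pos] at h1
    have hk2 : 1 ≤ f.2 * f.2 := by
      rcases lt_or_gt_of_ne hk with hlt | hgt
      · nlinarith
      · nlinarith
    nlinarith
  · rintro ⟨hk, hc⟩ x
    simp only [divFun, hk, zero_mul, add_zero]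
    exact hc

/-- An infinitely divisible integer is `0` (Prop. 3.2 (iii) for the tower's `Fn = ℤ²`). [cite: MochizukiEtTh2009, Prop 3.2 p.70] -/
theorem int_eq_zero_of_divisible (a : ℤ) (h : ∀ N : ℕ+, ∃ b : ℤ, ((N : ℕ) : ℤ) * b = a) : a = 0 := by
  obtain ⟨b, hb⟩ := h (Nat.succPNat a.natAbs)
  rw [Nat.succPNat_coe, Nat.cast_succ] at hb
  have habs := congrArg Int.natAbs hb
  rw [Int.natAbs_mul] at habs
  have h1 : ((a.natAbs : ℤ) + 1).natAbs = a.natAbs + 1 := by omega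
  rw [h1] at habs
  rcases Nat.eq_zero_or_pos b.natAbs with hb0 | hbpos
  · rw [Int.natAbs_eq_zero.mp hb0, mul_zero] at hb
    exact hb.symm
  · have h2 : a.natAbs + 1 ≤ (a.natAbs + 1) * b.natAbs := Nat.le_mul_of_pos_right _ hbpos
    omega

/-- **The Tate tower skeleton as an inhabitant of the Def. 3.1 / Prop. 3.2 interface** (every field proved).
[cite: MochizukiEtTh2009, Def 3.1 p.70] -/
def model : LogDivisorModel.{0} where
  Fn := Multiplicative (ℤ × ℤ)
  DIV := Multiplicative (Idx → ℤ)
  DIVplus :=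
    { carrier := {d | ∀ x, 0 ≤ Multiplicative.toAdd d x}
      mul_mem' := fun {a b} ha hb x => by
        rw [toAdd_mul, Pi.add_apply]; exact add_nonneg (ha x) (hb x)
      one_mem' := fun x => by rw [toAdd_one, Pi.zero_apply] }
  Div := ⊤
  exists_div_eq d := by
    refine ⟨Multiplicative.ofAdd fun x => max (Multiplicative.toAdd d x) 0, fun x => ?_,
      Multiplicative.ofAdd fun x => max (-Multiplicative.toAdd d x) 0, fun x => ?_, ?_⟩
    · rw [toAdd_ofAdd]; exact le_max_right _ _
    · rw [toAdd_ofAdd]; exact le_max_right _ _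
    · refine Multiplicative.toAdd.injective (funext fun x => ?_)
      rw [toAdd_mul, toAdd_ofAdd, toAdd_ofAdd, Pi.add_apply]
      rcases le_total 0 (Multiplicative.toAdd d x) with h | h
      · rw [max_eq_left h, max_eq_right (neg_nonpos.mpr h), add_zero]
      · rw [max_eq_right h, max_eq_left (neg_nonneg.mpr h), add_neg_cancel]
  eq_one_of_mem_of_inv_mem d hd hd' := by
    refine Multiplicative.toAdd.injective (funext fun x => le_antisymm ?_ (hd x))
    have h := hd' x
    rw [toAdd_inv, Pi.neg_apply] at h
    rw [toAdd_one, Pi.zero_apply]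
    linarith
  nonCuspidal := ⊤
  cuspidal := ⊥
  nonCuspidal_isCompl_cuspidal := isCompl_top_bot
  logMero := ⊤
  divisor := divHom.comp (Subgroup.subtype ⊤)
  divisor_mem_Div _ := trivial
  const := (AddMonoidHom.inl ℤ ℤ).toMultiplicative.range
  const_le_logMero := le_top
  intConst :=
    { carrier := {f | 0 ≤ (Multiplicative.toAdd f).1 ∧ (Multiplicative.toAdd f).2 = 0}
      mul_mem' := fun {a b} ha hb => by
        refine ⟨?_, ?_⟩
        · rw [toAdd_mul, Prod.fst_add]; exact add_nonneg ha.1 hb.1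
        · rw [toAdd_mul, Prod.snd_add, ha.2, hb.2, add_zero]
      one_mem' := ⟨le_rfl, rfl⟩ }
  intConst_le_const := by
    rintro f ⟨-, hf⟩
    refine ⟨Multiplicative.ofAdd (Multiplicative.toAdd f).1, ?_⟩
    refine Multiplicative.toAdd.injective (Prod.ext rfl ?_)
    change ((Multiplicative.toAdd f).1, (0 : ℤ)).2 = (Multiplicative.toAdd f).2
    rw [hf]
  temperedMero := ⊤
  temperedMero_le_logMero := le_rfl
  exists_pow_mem_Div := ⟨1, fun _ => trivial⟩
  Cusp := PEmpty.{1}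
  Comp := ℤ
  divPlusEquiv :=
    { toFun := fun d x => Multiplicative.ofAdd (Multiplicative.toAdd d.1 x).toNat
      invFun := fun m => ⟨Multiplicative.ofAdd fun x => ((Multiplicative.toAdd (m x) : ℕ) : ℤ), fun x => by
        rw [toAdd_ofAdd]; exact Int.natCast_nonneg _⟩
      left_inv := fun d => Subtype.ext (Multiplicative.toAdd.injective (funext fun x => by
        simp only [toAdd_ofAdd]
        exact Int.toNat_of_nonneg (d.2 x)))
      right_inv := fun m => funext fun x => by simp
      map_mul' := fun a b => funext fun x => by
        rw [Pi.mul_apply, ← ofAdd_add]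
        congr 1
        rw [Submonoid.coe_mul, toAdd_mul, Pi.add_apply]
        exact Int.toNat_add (a.2 x) (b.2 x) }
  divPlusEquiv_nonCuspidal d := ⟨fun _ c => c.elim, fun _ => trivial⟩
  mem_intConst_of_divisor_mem f hf := by
    have h : ∀ x, 0 ≤ divFun (Multiplicative.toAdd f.1) x := hf
    rw [divFun_nonneg_iff] at h
    exact ⟨h.2, h.1⟩
  divisor_mem_of_mem_intConst f hf := by
    refine ⟨fun x => ?_, trivial⟩
    change 0 ≤ divFun (Multiplicative.toAdd f.1) x
    exact (divFun_nonneg_iff _).2 ⟨hf.2, hf.1⟩ x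
  divisor_eq_one_iff f := by
    constructor
    · intro h
      have h' : ∀ x, divFun (Multiplicative.toAdd f.1) x = 0 := fun x => by
        have e := congrArg (fun d : Multiplicative (Idx → ℤ) => Multiplicative.toAdd d x) h
        rw [toAdd_one, Pi.zero_apply] at e
        exact e
      have hk : (Multiplicative.toAdd f.1).2 = 0 := by
        have h0 := h' (Sum.inr 0); have h1 := h' (Sum.inr 1)
        simp only [divFun, pos, mul_zero, add_zero, mul_one] at h0 h1
        linarith
      have hc : (Multiplicative.toAdd f.1).1 = 0 := by
        have h0 := h' (Sum.inr 0)
        simpa [divFun, pos] using h0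
      refine ⟨⟨hc.ge, hk⟩, ?_, ?_⟩
      · change 0 ≤ (Multiplicative.toAdd (f.1)⁻¹).1
        rw [toAdd_inv, Prod.fst_neg, hc, neg_zero]
      · change (Multiplicative.toAdd (f.1)⁻¹).2 = 0
        rw [toAdd_inv, Prod.snd_neg, hk, neg_zero]
    · rintro ⟨⟨hc, hk⟩, hc', -⟩
      have hc'' : (Multiplicative.toAdd f.1).1 ≤ 0 := by
        have : 0 ≤ (Multiplicative.toAdd (f.1)⁻¹).1 := hc'
        rw [toAdd_inv, Prod.fst_neg] at this
        linarith
      refine Multiplicative.toAdd.injective (funext fun x => ?_)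
      change divFun (Multiplicative.toAdd f.1) x = 0
      simp only [divFun, hk, zero_mul, add_zero]
      exact le_antisymm hc'' hc
  eq_one_of_forall_exists_pow_eq f hf := by
    -- an infinitely divisible element of `ℤ²` is trivial
    have h1 : ∀ N : ℕ+, ∃ b : ℤ, ((N : ℕ) : ℤ) * b = (Multiplicative.toAdd f).1 := fun N => by
      obtain ⟨g, hg⟩ := hf N
      refine ⟨(Multiplicative.toAdd g).1, ?_⟩
      have e := congrArg (fun u : Multiplicative (ℤ × ℤ) => (Multiplicative.toAdd u).1) hg
      rw [toAdd_pow, Prod.smul_fst, nsmul_eq_mul] at e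
      exact e
    have h2 : ∀ N : ℕ+, ∃ b : ℤ, ((N : ℕ) : ℤ) * b = (Multiplicative.toAdd f).2 := fun N => by
      obtain ⟨g, hg⟩ := hf N
      refine ⟨(Multiplicative.toAdd g).2, ?_⟩
      have e := congrArg (fun u : Multiplicative (ℤ × ℤ) => (Multiplicative.toAdd u).2) hg
      rw [toAdd_pow, Prod.smul_snd, nsmul_eq_mul] at e
      exact e
    exact Multiplicative.toAdd.injective
      (Prod.ext (int_eq_zero_of_divisible _ h1) (int_eq_zero_of_divisible _ h2))

/-! ## The Galois group `ℤ` of the tower acting by translation -/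

/-- Translation of the chain by `t`: `n ↦ n + t` on components (no cusps). [cite: MochizukiEtTh2009, Def 3.3 p.73] -/
def shiftIdx (t : ℤ) : Idx ≃ Idx := Equiv.sumCongr (Equiv.refl _) (Equiv.addRight t)
/-- `shiftIdx t (inr n) = inr (n + t)`. [cite: MochizukiEtTh2009, Def 3.3 p.73] -/
@[simp] theorem shiftIdx_inr (t n : ℤ) : shiftIdx t (Sum.inr n) = Sum.inr (n + t) := rfl
/-- `(shiftIdx t).symm (inr n) = inr (n - t)`. [cite: MochizukiEtTh2009, Def 3.3 p.73] -/
@[simp] theorem shiftIdx_symm_inr (t n : ℤ) : (shiftIdx t).symm (Sum.inr n) = Sum.inr (n - t) := by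
  rw [Equiv.symm_apply_eq, shiftIdx_inr, sub_add_cancel]
/-- Positions shift: `pos ((shiftIdx t).symm x) = pos x - t`. [cite: MochizukiEtTh2009, Def 3.3 p.73] -/
theorem pos_shiftIdx_symm (t : ℤ) (x : Idx) : pos ((shiftIdx t).symm x) = pos x - t := by
  rcases x with c | n
  · exact c.elim
  · rw [shiftIdx_symm_inr]; rfl

/-- The action of the translation `t` on log-divisors: `d ↦ d ∘ (shift t)⁻¹` (additively).
[cite: MochizukiEtTh2009, Def 3.3 p.73] -/
def shiftDIV (t : ℤ) : Multiplicative (Idx → ℤ) ≃* Multiplicative (Idx → ℤ) where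
  toFun d := Multiplicative.ofAdd fun x => Multiplicative.toAdd d ((shiftIdx t).symm x)
  invFun d := Multiplicative.ofAdd fun x => Multiplicative.toAdd d (shiftIdx t x)
  left_inv d := Multiplicative.toAdd.injective (funext fun x => by simp)
  right_inv d := Multiplicative.toAdd.injective (funext fun x => by simp)
  map_mul' a b := Multiplicative.toAdd.injective (funext fun x => by simp)
/-- `shiftDIV t d` evaluated. [cite: MochizukiEtTh2009, Def 3.3 p.73] -/
@[simp] theorem toAdd_shiftDIV (t : ℤ) (d : Multiplicative (Idx → ℤ)) (x : Idx) :
    Multiplicative.toAdd (shiftDIV t d) x = Multiplicative.toAdd d ((shiftIdx t).symm x) := by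
  simp [shiftDIV]

/-- The action of the translation `t` on functions: `ϖ^c U^k ↦ ϖ^{c - k t} U^k` (`U ∘ shift = ϖ^{-t} U`).
[cite: MochizukiEtTh2009, Def 3.3 p.73] -/
def shearFn (t : ℤ) : Multiplicative (ℤ × ℤ) ≃* Multiplicative (ℤ × ℤ) where
  toFun f := Multiplicative.ofAdd ((Multiplicative.toAdd f).1 - (Multiplicative.toAdd f).2 * t, (Multiplicative.toAdd f).2)
  invFun f := Multiplicative.ofAdd ((Multiplicative.toAdd f).1 + (Multiplicative.toAdd f).2 * t, (Multiplicative.toAdd f).2)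
  left_inv f := Multiplicative.toAdd.injective (Prod.ext (by simp) (by simp))
  right_inv f := Multiplicative.toAdd.injective (Prod.ext (by simp) (by simp))
  map_mul' a b := Multiplicative.toAdd.injective (Prod.ext (by simp; ring) (by simp))
/-- `shearFn t f` evaluated. [cite: MochizukiEtTh2009, Def 3.3 p.73] -/
@[simp] theorem toAdd_shearFn (t : ℤ) (f : Multiplicative (ℤ × ℤ)) :
    Multiplicative.toAdd (shearFn t f) =
      ((Multiplicative.toAdd f).1 - (Multiplicative.toAdd f).2 * t, (Multiplicative.toAdd f).2) := by
  simp [shearFn]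

/-- `G = ℤ` acting on the functions of the tower. [cite: MochizukiEtTh2009, Def 3.3 p.73] -/
def actFnHom : Multiplicative ℤ →* MulAut (Multiplicative (ℤ × ℤ)) where
  toFun g := shearFn (Multiplicative.toAdd g)
  map_one' := MulEquiv.ext fun f => Multiplicative.toAdd.injective (by simp)
  map_mul' g h := MulEquiv.ext fun f => Multiplicative.toAdd.injective (by
    rw [MulAut.mul_apply]
    simp only [toAdd_shearFn, toAdd_mul]
    refine Prod.ext ?_ rfl
    simp only
    ring)

/-- `G = ℤ` acting on the log-divisors of the tower. [cite: MochizukiEtTh2009, Def 3.3 p.73] -/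
def actDIVHom : Multiplicative ℤ →* MulAut (Multiplicative (Idx → ℤ)) where
  toFun g := shiftDIV (Multiplicative.toAdd g)
  map_one' := MulEquiv.ext fun d => Multiplicative.toAdd.injective (funext fun x => by
    rw [toAdd_shiftDIV, MulAut.one_apply, toAdd_one]
    rcases x with c | n
    · exact c.elim
    · rw [shiftIdx_symm_inr, sub_zero])
  map_mul' g h := MulEquiv.ext fun d => Multiplicative.toAdd.injective (funext fun x => by
    rw [MulAut.mul_apply, toAdd_shiftDIV, toAdd_shiftDIV, toAdd_shiftDIV, toAdd_mul]
    rcases x with c | n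
    · exact c.elim
    · simp only [shiftIdx_symm_inr, sub_sub])
/-- `G = ℤ` translating the components. [cite: MochizukiEtTh2009, Def 3.3 p.73] -/
def permCompHom : Multiplicative ℤ →* Equiv.Perm ℤ where
  toFun g := Equiv.addRight (Multiplicative.toAdd g)
  map_one' := Equiv.ext fun n => by simp
  map_mul' g h := Equiv.ext fun n => by
    rw [Equiv.Perm.mul_apply]
    simp only [Equiv.coe_addRight, toAdd_mul]
    ring

/-- **The Galois action of `G = ℤ` on the Tate tower skeleton** (every law proved): translation of the chain.
[cite: MochizukiEtTh2009, Def 3.3 p.73] -/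
def action : model.GaloisAction (Multiplicative ℤ) where
  actFn := actFnHom
  actDIV := actDIVHom
  permCusp := 1
  permComp := permCompHom
  act_mem_DIVplus g d hd x := by
    change 0 ≤ Multiplicative.toAdd (shiftDIV (Multiplicative.toAdd g) d) x
    rw [toAdd_shiftDIV]
    exact hd _
  act_mem_Div _ _ _ := trivial
  act_mem_logMero _ _ _ := trivial
  act_mem_const g f hf := by
    obtain ⟨c, rfl⟩ := hf
    refine ⟨c, Multiplicative.toAdd.injective ?_⟩
    change Multiplicative.toAdd ((AddMonoidHom.inl ℤ ℤ).toMultiplicative c) =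
      Multiplicative.toAdd (shearFn (Multiplicative.toAdd g) ((AddMonoidHom.inl ℤ ℤ).toMultiplicative c))
    rw [toAdd_shearFn]
    simp [AddMonoidHom.toMultiplicative]
  act_mem_intConst g f hf := by
    obtain ⟨hc, hk⟩ := hf
    refine ⟨?_, ?_⟩
    · change 0 ≤ (Multiplicative.toAdd (shearFn (Multiplicative.toAdd g) f)).1
      rw [toAdd_shearFn, hk, zero_mul, sub_zero]
      exact hc
    · change (Multiplicative.toAdd (shearFn (Multiplicative.toAdd g) f)).2 = 0
      rw [toAdd_shearFn]
      exact hk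
  divisor_act g f := by
    refine Multiplicative.toAdd.injective (funext fun x => ?_)
    change divFun (Multiplicative.toAdd (shearFn (Multiplicative.toAdd g) f.1)) x =
      Multiplicative.toAdd (shiftDIV (Multiplicative.toAdd g) (divHom f.1)) x
    rw [toAdd_shearFn, toAdd_shiftDIV, toAdd_divHom, pos_shiftIdx_symm]
    simp only [divFun]
    ring
  mult_act g d x := by
    rcases x with c | n
    · exact c.elim
    · change (Multiplicative.toAdd (shiftDIV (Multiplicative.toAdd g) d.1)
          (Sum.inr (Equiv.addRight (Multiplicative.toAdd g) n))).toNat = (Multiplicative.toAdd d.1 (Sum.inr n)).toNat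
      rw [toAdd_shiftDIV, Equiv.coe_addRight, shiftIdx_symm_inr, add_sub_cancel_right]
      rfl

/-- The tacit cusp laws hold for the tower (no cusps; every log-divisor Cartier). [cite: MochizukiEtTh2009, Def 3.1 p.70] -/
theorem cuspLaws : model.CuspLaws where
  cuspidal_le_Div := bot_le
  mem_cuspidal_iff d := by
    constructor
    · intro hd c
      have h1 : d = 1 := Subtype.ext (Subgroup.mem_bot.mp hd)
      rw [h1]
      exact model.mult_one _
    · intro h
      have h1 : d = 1 := model.eq_of_mult_eq fun x => by
        rcases x with c | n
        · exact c.elim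
        · rw [h n, model.mult_one]
      rw [h1]
      exact Subgroup.mem_bot.mpr rfl
/-! ## Non-vacuity of the constructed Def. 3.3 (iii) data at a NON-TRIVIAL action -/

/-- **The Def. 3.3 (iii) data of the Tate tower**: `DivisorMonoids.ofGaloisAction` at a non-trivial Galois action
exists. [cite: MochizukiEtTh2009, Def 3.3 p.73] -/
theorem nonempty_divisorMonoids : Nonempty (DivisorMonoids.{1, 0, 0} (Action (Type 0) (Multiplicative ℤ))) :=
  ⟨DivisorMonoids.ofGaloisAction action cuspLaws⟩

/-- The Tate coordinate `U` as an equivariant family on the regular `ℤ`-set `ℤ/1` (the covering `Z_∞` itself):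
`g ↦ g · U = ϖ^{-g} U`. [cite: MochizukiEtTh2009, Def 3.3 p.73] -/
def coordU : action.bZero (Action.leftRegular (Multiplicative ℤ)) :=
  ⟨fun g => action.actFn g (Multiplicative.ofAdd ((0 : ℤ), (1 : ℤ))), fun _ => trivial, fun g h => by
    change action.actFn ((Action.leftRegular (Multiplicative ℤ)).ρ g h) _ = _
    rw [Action.ofMulAction_apply, smul_eq_mul, map_mul, MulAut.mul_apply]⟩

/-- **`B₀(Z_∞) ≠ F₀(Z_∞)` in the tower**: the coordinate `U` is a log-meromorphic, NON-constant element of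
`B₀(ℤ/1)` — the constructed Def. 3.3 (iii) data are non-degenerate. [cite: MochizukiEtTh2009, Def 3.3 p.73] -/
theorem coordU_not_mem_fZero : coordU ∉ action.fZero (Action.leftRegular (Multiplicative ℤ)) := by
  intro h
  have h1 := h (1 : Multiplicative ℤ)
  change action.actFn 1 (Multiplicative.ofAdd ((0 : ℤ), (1 : ℤ))) ∈ model.const at h1
  rw [map_one, MulAut.one_apply] at h1
  obtain ⟨c, hc⟩ := h1
  have h2 := congrArg (fun f : Multiplicative (ℤ × ℤ) => (Multiplicative.toAdd f).2) hc
  change (0 : ℤ) = 1 at h2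
  exact zero_ne_one h2

end TateTower

end LogDivisorModel

end Literature.AnabelianGeometry.EtaleTheta

end
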